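import Literature.MathematicalPhysics.QuantumFieldTheory.Balaban1983to89.B1RT

/-!
# `Balaban1983to89.B1RTSemigroup` — T. Bałaban, *(Higgs)₂,₃ quantum fields in a finite volume. I. A lower bound*, Commun. Math. Phys. **85** (1982) 603–626 [Balaban1982Higgs1]: the semigroup law (2.14) and the k-fold composition law (2.16) of the renormalization transformations, TYPED as operator identities and PROVED

statement-level skeleton of published theorems with citation tags; proofs where landed; nothing here is a claim about the Yang–Mills mass gap

PDF held: `paper:balaban1982-cmp85-higgs23-i` (journal page = PDF page + 602); p. 608 [PDF 6] – p. 609 [PDF 7] read from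
the ×2 renders `…/pages/1982-cmp85-higgs23-I/…-p006-x2.png`, `…-p007-x2.png` of the cell `pub-balaban`.

CITATION HEADER — WHAT IS REPRODUCED.  SKELETON rows **B1.Eq2.14** and **B1.Eq2.16** of
`run/shared/lean/pub/lit-balaban/SKELETON.md` (both `absent` through v3.5: "(2.14) = (2.12) under the integral (2.4);
(2.16) its iteration"), over the carriers of the sibling `…Balaban1983to89.B1RT` (unit lit-balaban-r14; v1.1 PROVES
(2.12) = `B1RT.display212`): the Gaussian kernel `B1RT.rtKernel` (2.6)/(2.10), the block kernel `B1RT.blockKernel`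
(2.5), the operator `B1RT.rtOp` (2.4), the composed precision `B1RT.compPrec` ((2.12)–(2.13); = a_{k+1}(L^{k+1}ε)^{d−2}
for the printed data, `B1RT.prec_comp`), the sequence a_k of (2.15) = `B1.aSeq`.
p. 609 [PDF 7], verbatim: *"An easy Gaussian integration gives the formula [(2.12)] where a, a_k, a_{k+1} satisfy the
relation a_{k+1} = aa_k/(aL^{−2} + a_k). (2.13) From this formula we obtain
T^{L^kε}_{a,L,A}T^ε_{a_k,L^k,A} = T^ε_{a_{k+1},L^{k+1},A}. (2.14)  A sequence of numbers a_k satisfying the above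
recurrent equation and an initial condition a_1 = a is uniquely determined and it is equal to
a_k = a(1 − L^{−2})/(1 − L^{−2k}), a_k ↘ a_∞ = a(1 − L^{−2}) as k → ∞. (2.15)  Thus we get the following formula for the
composition of k successive renormalization transformations T^{L^{k−1}ε}_{a,L,A} … T^{Lε}_{a,L,A}T^ε_{a,L,A} = T^ε_{a_k,L^k,A}.
(2.16)"*
(p. 608 [PDF 6]: the contours Γ^{(k+1)}_{z,x} = Γ_{z,y} ∪ Γ^{(k)}_{y,x} of (2.2), so that the transports multiply along the
tower of lattices T^{(j)}_{L^jε} of (1.19)–(1.20), p. 607.)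

DICTIONARY.  (2.14): `Z` ↤ the coarse sites (a subset Ω″ of T^{(k+1)}), `Z × B` ↤ the middle sites B(Ω″) ⊂ T^{(k)} — a
middle site y ∈ B(z) IS the pair (z, b) of its block and its position in the block, `B` ↤ the L^d positions (1.17) —,
`X` ↤ the fine sites; `qAvg w u θ z = w • Σ_b u(z,b) θ(z,b)` ↤ (Q(A)θ)(z) of (2.7) with `w` ↤ L^{−d}, `u (z,b)` ↤
U(A(Γ_{z,y})) ∈ O(N); `m` ↤ Q_k(A) of (2.11) (ANY measurable map of the fine field: only Q(A) ∘ Q_k(A) = Q_{k+1}(A), the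
concatenation (2.2), enters); `α` ↤ a(L^{k+1}ε)^{d−2}, `β` ↤ a_k(L^kε)^{d−2}; densities ρ ↤ ρ(A,·) integrable in the fine
field.  (2.16): `Sites B Z n` ↤ the lattice n levels below Z = T^{(k)} (iterated pairs), `rtChain` ↤ the left side of
(2.16) (n one-step transformations composed, coarsest last), `chainAvg` ↤ Q_n(A), `chainPrec` ↤ the composed
precision, `precSeq a L ε d k j` ↤ a(L^{k−j}ε)^{d−2} = the constant of the step T^{L^{k−j−1}ε}_{a,L,A} ((2.6)).
KERNEL-CHECKED: `display214` ((2.14) for all α, β > 0, w, isometric u, measurable m, integrable ρ — (2.12) block by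
block, `integral_blockKernel_mul_prod_rtKernel`, after the measure-preserving uncurrying (Z → B → V) ≃ (Z × B → V),
`measurePreserving_curry_symm`, then Fubini against ρ); `rtChain_succ_eq` (a chain of n+1 steps IS one (n+1)-st order
transformation (2.10): induction, each step = `display214`); `chainPrec_printed` (for the printed constants the composed
precision is a_k(L^kε)^{d−2}: `B1RT.prec_comp` + `B1.aSeq_succ`); `display216` ((2.16) as printed: k ≥ 1, a, ε > 0,
L > 1, |B| = L^d).  NOT typed: the contours (2.1)–(2.2) as lattice paths (their consequence — multiplicativity of the
transports down the tower — is the shape of the data `u`); the empty chain `rtChain … 0` is the identity by definition.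
Unit `lit-balaban-r14` (gen 2), HOME `run/shared/lean/pub/lit-balaban/` (ROWS-B1.md rows B1.Eq2.14, B1.Eq2.16).
-/

open scoped BigOperators ENNReal
open _root_.MeasureTheory _root_.Real

namespace Literature.MathematicalPhysics.QuantumFieldTheory.Balaban1983to89.B1RTSemigroup

open B1RT

/-! ## (2.14) p. 609: the semigroup law of the renormalization transformations — TYPED and PROVED -/

section SemigroupLaw

variable {V : Type*} [NormedAddCommGroup V] [InnerProductSpace ℝ V] [FiniteDimensional ℝ V]
  [MeasurableSpace V] [BorelSpace V]
variable {Z B X : Type*} [Fintype Z] [Fintype B] [Fintype X]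

/-- The block average (2.7) over the block model `Z × B`: `(Q(A)θ)(z) = w Σ_{b} U(A(Γ_{z,(z,b)})) θ(z,b)`.
[cite: Balaban1982Higgs1, (2.7) p.608] -/
def qAvg (w : ℝ) (u : Z × B → (V ≃ₗᵢ[ℝ] V)) (θ : Z × B → V) (z : Z) : V :=
  w • ∑ b, u (z, b) (θ (z, b))

omit [FiniteDimensional ℝ V] [MeasurableSpace V] [BorelSpace V] [Fintype Z] in
/-- Unfolding lemma (definitional). [cite: Balaban1982Higgs1, (2.7) p.608] -/
theorem qAvg_apply (w : ℝ) (u : Z × B → (V ≃ₗᵢ[ℝ] V)) (θ : Z × B → V) (z : Z) :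
    qAvg w u θ z = w • ∑ b, u (z, b) (θ (z, b)) := rfl

/-- Uncurrying `(Z → B → V) → (Z × B → V)` preserves the product Lebesgue measures (boxes of boxes are boxes;
`Measure.pi_eq`). [cite: Balaban1982Higgs1, (2.5) p.608] -/
theorem measurePreserving_curry_symm_pi :
    MeasurePreserving (MeasurableEquiv.curry Z B V).symm
      (Measure.pi fun _ : Z => Measure.pi fun _ : B => (volume : Measure V))
      (Measure.pi fun _ : Z × B => (volume : Measure V)) := by
  refine ⟨(MeasurableEquiv.curry Z B V).symm.measurable, ?_⟩
  symm
  refine Measure.pi_eq fun s hs => ?_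
  rw [Measure.map_apply (MeasurableEquiv.curry Z B V).symm.measurable (MeasurableSet.univ_pi hs)]
  have hpre : (MeasurableEquiv.curry Z B V).symm ⁻¹' Set.pi Set.univ s
      = Set.pi Set.univ (fun z => Set.pi Set.univ (fun b => s (z, b))) := by
    ext g
    simp [MeasurableEquiv.coe_curry_symm, Function.uncurry]
  rw [hpre, Measure.pi_pi]
  simp_rw [Measure.pi_pi]
  rw [Fintype.prod_prod_type]

/-- The same for the canonical `volume`s (which ARE these product measures). [cite: Balaban1982Higgs1, (2.5) p.608] -/
theorem measurePreserving_curry_symm :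
    MeasurePreserving (MeasurableEquiv.curry Z B V).symm
      (volume : Measure (Z → B → V)) (volume : Measure (Z × B → V)) :=
  measurePreserving_curry_symm_pi

/-- **Block factorization of the θ-integral** (the step from (2.12) to (2.14)): integrating the middle field θ over ALL
blocks at once, the product kernel factorizes over the coarse sites z and each factor is (2.12):
`∫dθ Π_z t_α(ψ(z) − (Q(A)θ)(z)) Π_y t_β(θ(y) − c(y)) = Π_z t_γ(ψ(z) − w Σ_b U c(z,b))`, γ = `compPrec α β w |B|`.
[cite: Balaban1982Higgs1, (2.12)–(2.14) p.609] -/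
theorem integral_blockKernel_mul_prod_rtKernel {α β : ℝ} (hα : 0 < α) (hβ : 0 < β) (w : ℝ)
    (u : Z × B → (V ≃ₗᵢ[ℝ] V)) (c : Z × B → V) (ψ : Z → V) :
    ∫ θ : Z × B → V, (∏ z, rtKernel α (ψ z - qAvg w u θ z)) * ∏ y, rtKernel β (θ y - c y)
      = ∏ z, rtKernel (compPrec α β w (Fintype.card B)) (ψ z - w • ∑ b, u (z, b) (c (z, b))) := by
  -- the per-block factor
  set G : Z → (B → V) → ℝ := fun z η =>
    rtKernel α (ψ z - w • ∑ b, u (z, b) (η b)) * ∏ b, rtKernel β (η b - c (z, b)) with hG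
  have hfac : ∀ θ : Z × B → V, (∏ z, rtKernel α (ψ z - qAvg w u θ z)) * ∏ y, rtKernel β (θ y - c y)
      = ∏ z, G z (fun b => θ (z, b)) := by
    intro θ
    rw [Fintype.prod_prod_type, ← Finset.prod_mul_distrib]
    rfl
  simp_rw [hfac]
  -- transport along the uncurrying
  have hmp := measurePreserving_curry_symm (V := V) (Z := Z) (B := B)
  rw [← hmp.integral_comp']
  have happ : ∀ (g : Z → B → V), (∏ z, G z (fun b => (MeasurableEquiv.curry Z B V).symm g (z, b)))
      = ∏ z, G z (g z) := by
    intro g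
    rfl
  simp_rw [happ]
  rw [volume_pi, integral_fintype_prod_eq_prod (𝕜 := ℝ) (fun z η => G z η)]
  refine Finset.prod_congr rfl fun z _ => ?_
  exact display212 V B hα hβ w (fun b => u (z, b)) (fun b => c (z, b)) (ψ z)

omit [FiniteDimensional ℝ V] [MeasurableSpace V] [BorelSpace V] [Fintype Z] [Fintype B] [Fintype X] in
/-- The kernel (2.6) is bounded by its prefactor: `t_κ(v) ≤ (κ/2π)^{N/2}` (κ ≥ 0). [cite: Balaban1982Higgs1, (2.6) p.608] -/
theorem rtKernel_le {κ : ℝ} (hκ : 0 ≤ κ) (v : V) :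
    rtKernel κ v ≤ (κ / (2 * π)) ^ ((Module.finrank ℝ V : ℝ) / 2) := by
  unfold rtKernel
  have h1 : 0 ≤ (κ / (2 * π)) ^ ((Module.finrank ℝ V : ℝ) / 2) := Real.rpow_nonneg (by positivity) _
  have h2 : Real.exp (-(κ / 2) * ‖v‖ ^ 2) ≤ 1 := by
    rw [Real.exp_le_one_iff]
    nlinarith [sq_nonneg ‖v‖]
  calc (κ / (2 * π)) ^ ((Module.finrank ℝ V : ℝ) / 2) * Real.exp (-(κ / 2) * ‖v‖ ^ 2)
      ≤ (κ / (2 * π)) ^ ((Module.finrank ℝ V : ℝ) / 2) * 1 := mul_le_mul_of_nonneg_left h2 h1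
    _ = _ := mul_one _

variable (V) in
/-- **(2.14)** p. 609 TYPED: the semigroup law `T^{L^kε}_{a,L,A} T^ε_{a_k,L^k,A} = T^ε_{a_{k+1},L^{k+1},A}` as an identity of
the operators (2.4) on integrable densities ρ of the fine field: applying the k-th order transformation (kernel (2.10),
precision β, block averages `m` = Q_k(A)) and then the one-step transformation (kernel (2.6), precision α, block average
Q(A) = `qAvg w u`) equals the (k+1)-st order transformation (precision γ = `compPrec α β w |B|`, block average Q_{k+1}(A) =
Q(A) ∘ Q_k(A) by (2.2)). [cite: Balaban1982Higgs1, (2.14) p.609] -/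
def Display214 (α β w : ℝ) (u : Z × B → (V ≃ₗᵢ[ℝ] V)) (m : (X → V) → Z × B → V) (ρ : (X → V) → ℝ) : Prop :=
  rtOp (blockKernel α (qAvg w u)) (rtOp (blockKernel β m) ρ)
    = rtOp (blockKernel (compPrec α β w (Fintype.card B)) (fun φ => qAvg w u (m φ))) ρ

/-- Unfolding lemma (definitional). [cite: Balaban1982Higgs1, (2.14) p.609] -/
theorem display214_iff (α β w : ℝ) (u : Z × B → (V ≃ₗᵢ[ℝ] V)) (m : (X → V) → Z × B → V)
    (ρ : (X → V) → ℝ) : Display214 V α β w u m ρ ↔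
      ∀ ψ : Z → V, ∫ θ : Z × B → V, blockKernel α (qAvg w u) ψ θ * ∫ φ : X → V, blockKernel β m θ φ * ρ φ
        = ∫ φ : X → V, blockKernel (compPrec α β w (Fintype.card B)) (fun φ => qAvg w u (m φ)) ψ φ * ρ φ := by
  simp only [Display214, funext_iff, rtOp_eq]

/-- **(2.14)** p. 609, KERNEL: the semigroup law holds for all precisions α, β > 0, every weight w, all isometric transports
u, every MEASURABLE block-average map m of the fine field (the printed Q_k(A) is linear) and every INTEGRABLE density ρ
(Fubini: the joint integrand is dominated by ‖ρ‖ times a bounded kernel; the θ-integral is `integral_blockKernel_mul_prod_rtKernel`,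
i.e. (2.12) block by block). [cite: Balaban1982Higgs1, (2.14) p.609] -/
theorem display214 {α β : ℝ} (hα : 0 < α) (hβ : 0 < β) (w : ℝ) (u : Z × B → (V ≃ₗᵢ[ℝ] V))
    {m : (X → V) → Z × B → V} (hm : Measurable m) {ρ : (X → V) → ℝ} (hρ : Integrable ρ) :
    Display214 V α β w u m ρ := by
  rw [display214_iff]
  intro ψ
  set γ := compPrec α β w (Fintype.card B) with hγdef
  have hγ : 0 < γ := compPrec_pos hα hβ w _
  -- the joint integrand
  set F : (Z × B → V) → (X → V) → ℝ := fun θ φ =>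
    blockKernel α (qAvg w u) ψ θ * (blockKernel β m θ φ * ρ φ) with hF
  -- the θ-integral, block by block = (2.12)
  have hθ : ∀ φ : X → V, ∫ θ : Z × B → V, blockKernel α (qAvg w u) ψ θ * blockKernel β m θ φ
      = blockKernel γ (fun φ => qAvg w u (m φ)) ψ φ := by
    intro φ
    simp only [blockKernel_eq]
    rw [integral_blockKernel_mul_prod_rtKernel hα hβ w u (m φ) ψ]
    rfl
  -- measurability of the joint integrand
  have hmeasK : Measurable fun p : (Z × B → V) × (X → V) =>
      blockKernel α (qAvg w u) ψ p.1 * blockKernel β m p.1 p.2 := by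
    refine Measurable.mul ?_ ?_
    · have hc : Continuous fun θ : Z × B → V => blockKernel α (qAvg w u) ψ θ := by
        simp only [blockKernel_eq, qAvg]
        refine continuous_finsetProd _ fun z _ => (continuous_rtKernel α).comp (continuous_const.sub ?_)
        exact continuous_const.smul (continuous_finsetSum _ fun b _ => (u (z, b)).continuous.comp (continuous_apply _))
      exact hc.measurable.comp measurable_fst
    · simp only [blockKernel_eq]
      refine Finset.measurable_prod _ fun y _ => (continuous_rtKernel β).measurable.comp ?_
      exact ((measurable_pi_apply y).comp measurable_fst).sub ((measurable_pi_apply y).comp (hm.comp measurable_snd))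
  have hFm : AEStronglyMeasurable (Function.uncurry F)
      ((volume : Measure (Z × B → V)).prod (volume : Measure (X → V))) := by
    have h2 : AEStronglyMeasurable (fun p : (Z × B → V) × (X → V) => ρ p.2)
        ((volume : Measure (Z × B → V)).prod (volume : Measure (X → V))) := hρ.1.comp_snd
    have h1 := hmeasK.aestronglyMeasurable (μ := (volume : Measure (Z × B → V)).prod (volume : Measure (X → V)))
    have h3 := h1.mul h2
    refine h3.congr (Filter.Eventually.of_forall fun p => ?_)
    obtain ⟨θ, φ⟩ := p
    simp only [hF, Pi.mul_apply, Function.uncurry_apply_pair, mul_assoc]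
  -- integrability on the product
  have hnn : ∀ θ φ, 0 ≤ blockKernel α (qAvg w u) ψ θ * blockKernel β m θ φ := fun θ φ =>
    mul_nonneg (blockKernel_nonneg hα.le _ _ _) (blockKernel_nonneg hβ.le _ _ _)
  have hint : Integrable (Function.uncurry F)
      ((volume : Measure (Z × B → V)).prod (volume : Measure (X → V))) := by
    rw [integrable_prod_iff' hFm]
    refine ⟨Filter.Eventually.of_forall fun φ => ?_, ?_⟩
    · -- θ-sections: a positive multiple... of an integrand with non-zero integral
      have hI : Integrable (fun θ : Z × B → V => blockKernel α (qAvg w u) ψ θ * blockKernel β m θ φ) := by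
        by_cases hz : blockKernel γ (fun φ => qAvg w u (m φ)) ψ φ = 0
        · -- then some factor vanishes: impossible, kernels are positive — so this case is vacuous
          exfalso
          simp only [blockKernel_eq] at hz
          obtain ⟨z, -, hz0⟩ := Finset.prod_eq_zero_iff.mp hz
          exact (rtKernel_pos hγ _).ne' hz0
        · exact Integrable.of_integral_ne_zero (by rw [hθ φ]; exact hz)
      simpa [hF, Function.uncurry, mul_assoc] using hI.mul_const (ρ φ)
    · -- φ ↦ ∫‖F(θ,φ)‖dθ = (blockKernel γ …)(φ)·‖ρ φ‖, bounded kernel × integrable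
      have hpt : ∀ φ : X → V, ∫ θ : Z × B → V, ‖Function.uncurry F (θ, φ)‖
          = blockKernel γ (fun φ => qAvg w u (m φ)) ψ φ * ‖ρ φ‖ := by
        intro φ
        have : ∀ θ : Z × B → V, ‖Function.uncurry F (θ, φ)‖
            = blockKernel α (qAvg w u) ψ θ * blockKernel β m θ φ * ‖ρ φ‖ := by
          intro θ
          simp only [hF, Function.uncurry_apply_pair, norm_mul, Real.norm_of_nonneg (blockKernel_nonneg hα.le _ _ _),
            Real.norm_of_nonneg (blockKernel_nonneg hβ.le _ _ _), mul_assoc]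
        simp_rw [this]
        rw [integral_mul_const, hθ φ]
      simp_rw [hpt]
      have hbm : Measurable fun φ : X → V => blockKernel γ (fun φ => qAvg w u (m φ)) ψ φ := by
        simp only [blockKernel_eq, qAvg]
        refine Finset.measurable_prod _ fun z _ => (continuous_rtKernel γ).measurable.comp (measurable_const.sub ?_)
        refine Measurable.const_smul (Finset.measurable_sum _ fun b _ => ?_) _
        exact (u (z, b)).continuous.measurable.comp ((measurable_pi_apply _).comp hm)
      refine Integrable.bdd_mul hρ.norm hbm.aestronglyMeasurable
        (c := ∏ _z : Z, (γ / (2 * π)) ^ ((Module.finrank ℝ V : ℝ) / 2)) (Filter.Eventually.of_forall fun φ => ?_)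
      rw [Real.norm_of_nonneg (blockKernel_nonneg hγ.le _ _ _), blockKernel_eq]
      exact Finset.prod_le_prod (fun z _ => rtKernel_nonneg hγ.le _) fun z _ => rtKernel_le hγ.le _
  -- assemble: pull the outer kernel inside, swap, integrate θ first
  calc ∫ θ : Z × B → V, blockKernel α (qAvg w u) ψ θ * ∫ φ : X → V, blockKernel β m θ φ * ρ φ
      = ∫ θ : Z × B → V, ∫ φ : X → V, F θ φ := by
        refine integral_congr_ae (Filter.Eventually.of_forall fun θ => ?_)
        simp only [hF]
        rw [integral_const_mul]
    _ = ∫ φ : X → V, ∫ θ : Z × B → V, F θ φ := integral_integral_swap hint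
    _ = ∫ φ : X → V, blockKernel γ (fun φ => qAvg w u (m φ)) ψ φ * ρ φ := by
        refine integral_congr_ae (Filter.Eventually.of_forall fun φ => ?_)
        simp only [hF]
        simp_rw [← mul_assoc]
        rw [integral_mul_const, hθ φ]

end SemigroupLaw

/-! ## (2.16) p. 609: k successive renormalization transformations — TYPED and PROVED

(2.16), verbatim: *"Thus we get the following formula for the composition of k successive renormalization transformations
T^{L^{k−1}ε}_{a,L,A}·…·T^{Lε}_{a,L,A}T^ε_{a,L,A} = T^ε_{a_k,L^k,A}."*  DICTIONARY: the tower of lattices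
T_ε = T^{(0)}, T^{(1)}_{Lε}, …, T^{(k)}_{L^kε} of (1.19)–(1.20) below a coarsest lattice `Z` ↤ T^{(k)} is `Sites B Z n` ↤ the
sites of T^{(k−n)} (n levels below Z; a site = its ancestor in Z and the n successive positions in the blocks, |B| = L^d);
`rtChain w n κ Z u ρ` ↤ the composition of the n one-step transformations (2.4)–(2.6) applied to a density ρ of the fields
on the finest lattice, the COARSEST step having precision `κ 0` and transports `u 0`, the next `κ 1`, `u 1`, …;
`chainAvg` ↤ the composed block average Q_n(A) of (2.11) (iterating (2.2)); `chainPrec` ↤ the composed precision, which for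
the printed data κ_j = a(L^{k−j}ε)^{d−2}, w = L^{−d} IS a_k(L^kε)^{d−2} with a_k of (2.15) (`chainPrec_printed`). -/

section Chain

universe u

variable {V : Type*} [NormedAddCommGroup V] [InnerProductSpace ℝ V] [FiniteDimensional ℝ V]
  [MeasurableSpace V] [BorelSpace V]
variable (B : Type u) [Fintype B]

omit [Fintype B] in
/-- The tower of lattices (1.19)–(1.20) below a lattice `Z` when every site has the |B| children of its block:
`Sites B Z 0 = Z`, `Sites B Z (n+1) = Sites B (Z × B) n` (a site n levels below z ∈ Z = the nested pair
((z, b₁), …, b_n) of its successive block positions). [cite: Balaban1982Higgs1, (1.19)–(1.20) p.607] -/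
def Sites : Type u → ℕ → Type u
  | Z, 0 => Z
  | Z, n + 1 => Sites (Z × B) n

/-- Finiteness of the tower lattices. [cite: Balaban1982Higgs1, (1.19)–(1.20) p.607] -/
instance instFintypeSites : (Z : Type u) → [Fintype Z] → (n : ℕ) → Fintype (Sites B Z n)
  | Z, _, 0 => ‹Fintype Z›
  | Z, _, n + 1 => instFintypeSites (Z × B) n

variable {B}

/-- **The left side of (2.16)**: n successive one-step renormalization transformations (2.4)–(2.6) from the lattice n
levels below `Z` up to `Z`, composed — the coarsest step (precision `κ 0`, transports `u 0 : Z × B → O(V)`) applied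
last, after the chain of the n − 1 finer steps (precisions `κ 1, κ 2, …`) based at `Z × B`.
[cite: Balaban1982Higgs1, (2.16) p.609] -/
noncomputable def rtChain (w : ℝ) : (n : ℕ) → (κ : ℕ → ℝ) → (Z : Type u) → [Fintype Z] →
    ((j : ℕ) → Sites B Z j × B → (V ≃ₗᵢ[ℝ] V)) → ((Sites B Z n → V) → ℝ) → (Z → V) → ℝ
  | 0, _, _, _, _, ρ => ρ
  | n + 1, κ, Z, _, u, ρ =>
      rtOp (blockKernel (κ 0) (qAvg w (u 0)))
        (rtChain w n (fun j => κ (j + 1)) (Z × B) (fun j => u (j + 1)) ρ)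

/-- A chain of zero steps is the identity on densities (the empty composition; the printed chains (2.16) have k ≥ 1).
[cite: Balaban1982Higgs1, (2.16) p.609] -/
theorem rtChain_zero (w : ℝ) (κ : ℕ → ℝ) (Z : Type u) [Fintype Z]
    (u : (j : ℕ) → Sites B Z j × B → (V ≃ₗᵢ[ℝ] V)) (ρ : (Sites B Z 0 → V) → ℝ) :
    rtChain w 0 κ Z u ρ = ρ := rfl

/-- One more (coarsest) step: the (n+1)-chain is the one-step transformation (2.4)–(2.6) with precision `κ 0` and block
average `qAvg w (u 0)` applied to the n-chain based at `Z × B` (definitional). [cite: Balaban1982Higgs1, (2.16) p.609] -/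
theorem rtChain_succ (w : ℝ) (n : ℕ) (κ : ℕ → ℝ) (Z : Type u) [Fintype Z]
    (u : (j : ℕ) → Sites B Z j × B → (V ≃ₗᵢ[ℝ] V)) (ρ : (Sites B Z (n + 1) → V) → ℝ) :
    rtChain w (n + 1) κ Z u ρ
      = rtOp (blockKernel (κ 0) (qAvg w (u 0)))
          (rtChain w n (fun j => κ (j + 1)) (Z × B) (fun j => u (j + 1)) ρ) := rfl

/-- The composed block average Q_n(A) of (2.11) down the tower: `chainAvg w 0 = id`,
`chainAvg w (n+1) Z u φ = Q(A)[u 0] (chainAvg w n (Z × B) (u ∘ succ) φ)` — the concatenation of contours (2.2).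
[cite: Balaban1982Higgs1, (2.2) p.608, (2.11) p.609] -/
def chainAvg (w : ℝ) : (n : ℕ) → (Z : Type u) →
    ((j : ℕ) → Sites B Z j × B → (V ≃ₗᵢ[ℝ] V)) → (Sites B Z n → V) → Z → V
  | 0, _, _, φ => φ
  | n + 1, Z, u, φ => qAvg w (u 0) (chainAvg w n (Z × B) (fun j => u (j + 1)) φ)

/-- The composed precision of an n-step chain (n ≥ 1): `chainPrec 1 κ = κ 0`,
`chainPrec (n+2) κ = compPrec (κ 0) (chainPrec (n+1) (κ ∘ succ)) w |B|` (one application of (2.13) per step; the value at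
n = 0 is a placeholder — a 0-step chain is the identity, not a Gaussian transformation).
[cite: Balaban1982Higgs1, (2.13) p.609, (2.16) p.609] -/
noncomputable def chainPrec (w : ℝ) (nB : ℕ) : (n : ℕ) → (κ : ℕ → ℝ) → ℝ
  | 0, κ => κ 0
  | 1, κ => κ 0
  | n + 2, κ => compPrec (κ 0) (chainPrec w nB (n + 1) (fun j => κ (j + 1))) w nB

/-- The composed precision is positive when all step precisions are. [cite: Balaban1982Higgs1, (2.13) p.609] -/
theorem chainPrec_pos (w : ℝ) (nB : ℕ) : ∀ (n : ℕ) (κ : ℕ → ℝ), (∀ j, 0 < κ j) → 0 < chainPrec w nB n κ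
  | 0, κ, hκ => hκ 0
  | 1, κ, hκ => hκ 0
  | n + 2, κ, hκ => by
      rw [chainPrec]
      exact compPrec_pos (hκ 0) (chainPrec_pos w nB (n + 1) _ fun j => hκ (j + 1)) w nB

omit [FiniteDimensional ℝ V] [MeasurableSpace V] [BorelSpace V] in
/-- The composed block average is continuous (it is linear) in the fine field. [cite: Balaban1982Higgs1, (2.11) p.609] -/
theorem continuous_chainAvg (w : ℝ) : ∀ (n : ℕ) (Z : Type u) [Fintype Z]
    (u : (j : ℕ) → Sites B Z j × B → (V ≃ₗᵢ[ℝ] V)), Continuous (chainAvg (V := V) w n Z u)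
  | 0, _, _, _ => continuous_id
  | n + 1, Z, _, u => by
      have ih := continuous_chainAvg w n (Z × B) (fun j => u (j + 1))
      refine continuous_pi fun z => ?_
      simp only [chainAvg, qAvg]
      refine continuous_const.smul (continuous_finsetSum _ fun b _ => ?_)
      exact (u 0 (z, b)).continuous.comp ((continuous_apply _).comp ih)

/-- **(2.16) in general form**, KERNEL: a chain of n + 1 one-step transformations with positive precisions IS the single
(n+1)-st order transformation (2.10) with the composed precision `chainPrec` and the composed block average `chainAvg`, on
every integrable density — induction on n, each step being the semigroup law (2.14) (`display214`).
[cite: Balaban1982Higgs1, (2.16) p.609] -/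
theorem rtChain_succ_eq (w : ℝ) : ∀ (n : ℕ) (κ : ℕ → ℝ) (_hκ : ∀ j, 0 < κ j) (Z : Type u) [Fintype Z]
    (u : (j : ℕ) → Sites B Z j × B → (V ≃ₗᵢ[ℝ] V)) (ρ : (Sites B Z (n + 1) → V) → ℝ) (_hρ : Integrable ρ),
    rtChain w (n + 1) κ Z u ρ
      = rtOp (blockKernel (chainPrec w (Fintype.card B) (n + 1) κ) (chainAvg w (n + 1) Z u)) ρ
  | 0, κ, _, Z, _, u, ρ, _ => rfl
  | n + 1, κ, hκ, Z, _, u, ρ, hρ => by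
      have ih := rtChain_succ_eq w n (fun j => κ (j + 1)) (fun j => hκ (j + 1)) (Z × B) (fun j => u (j + 1)) ρ hρ
      have h214 : rtOp (blockKernel (κ 0) (qAvg w (u 0)))
          (rtOp (blockKernel (chainPrec w (Fintype.card B) (n + 1) (fun j => κ (j + 1)))
            (chainAvg w (n + 1) (Z × B) (fun j => u (j + 1)))) ρ)
          = rtOp (blockKernel (compPrec (κ 0) (chainPrec w (Fintype.card B) (n + 1) (fun j => κ (j + 1))) w
              (Fintype.card B)) (fun φ => qAvg w (u 0) (chainAvg w (n + 1) (Z × B) (fun j => u (j + 1)) φ))) ρ :=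
        display214 (hκ 0) (chainPrec_pos w _ (n + 1) _ fun j => hκ (j + 1)) w (u 0)
          (continuous_chainAvg w (n + 1) (Z × B) (fun j => u (j + 1))).measurable hρ
      rw [rtChain, ih]
      exact h214

/-! ### The printed data: κ_j = a(L^{k−j}ε)^{d−2}, w = L^{−d}, |B| = L^d -/

/-- The precisions of the printed chain (2.16): the step producing the lattice j levels below the top T^{(k)} (i.e. the
transformation T^{L^{k−j−1}ε}_{a,L,A}: T^{(k−j−1)} → T^{(k−j)}) has kernel constant a(L^{k−j}ε)^{d−2} ((2.6) with L^kε
there ↤ L^{k−j−1}ε here). [cite: Balaban1982Higgs1, (2.6) p.608, (2.16) p.609] -/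
noncomputable def precSeq (a : ℝ) (L : ℕ) (ε : ℝ) (d k : ℕ) (j : ℕ) : ℝ := prec a ((L : ℝ) ^ (k - j) * ε) d

/-- Unfolding lemma (definitional). [cite: Balaban1982Higgs1, (2.6) p.608] -/
theorem precSeq_eq (a : ℝ) (L : ℕ) (ε : ℝ) (d k j : ℕ) :
    precSeq a L ε d k j = prec a ((L : ℝ) ^ (k - j) * ε) d := rfl

/-- Shifting the printed precisions one level down the tower. [cite: Balaban1982Higgs1, (2.16) p.609] -/
theorem precSeq_succ (a : ℝ) (L : ℕ) (ε : ℝ) (d k j : ℕ) :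
    precSeq a L ε d (k + 1) (j + 1) = precSeq a L ε d k j := by
  simp only [precSeq_eq, Nat.add_sub_add_right]

/-- The printed precisions are positive (a, ε > 0, L ≥ 1). [cite: Balaban1982Higgs1, (2.6) p.608] -/
theorem precSeq_pos {a : ℝ} {L : ℕ} {ε : ℝ} (ha : 0 < a) (hL : 0 < L) (hε : 0 < ε) (d k j : ℕ) :
    0 < precSeq a L ε d k j := by
  rw [precSeq_eq]
  exact prec_pos ha (by positivity) d

/-- **The scalar content of (2.16)**, KERNEL: for the printed data the composed precision of the k-step chain IS
a_k(L^kε)^{d−2} with a_k the sequence (2.15) (`B1.aSeq`; one use of (2.12)–(2.13) = `prec_comp` per step and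
`B1.aSeq_succ`). [cite: Balaban1982Higgs1, (2.13), (2.15), (2.16) p.609] -/
theorem chainPrec_printed {a : ℝ} {L : ℕ} {ε : ℝ} (ha : 0 < a) (hL : 1 < L) (hε : 0 < ε) (d : ℕ) :
    ∀ k : ℕ, 1 ≤ k → chainPrec (((L : ℝ) ^ d)⁻¹) (L ^ d) k (precSeq a L ε d k)
      = prec (B1.aSeq a L k) ((L : ℝ) ^ k * ε) d := by
  have hL' : (1 : ℝ) < L := by exact_mod_cast hL
  have hL0 : 0 < L := lt_trans Nat.zero_lt_one hL
  intro k hk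
  induction k, hk using Nat.le_induction with
  | base => simp [chainPrec, precSeq_eq, B1.aSeq_one hL']
  | succ k hk ih =>
    obtain ⟨m, rfl⟩ : ∃ m, k = m + 1 := ⟨k - 1, by omega⟩
    rw [chainPrec]
    have hshift : (fun j => precSeq a L ε d (m + 1 + 1) (j + 1)) = precSeq a L ε d (m + 1) := by
      funext j
      exact precSeq_succ a L ε d (m + 1) j
    rw [hshift, ih, precSeq_eq, Nat.sub_zero, pow_succ, mul_comm ((L : ℝ) ^ (m + 1)) (L : ℝ), mul_assoc,
      prec_comp ha (B1.aSeq_pos ha hL' hk) hL0 (by positivity), aNext_eq_aSeq_succ ha hL' hk]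

/-- **(2.16)** p. 609, KERNEL, for the printed data: on the tower of lattices with |B| = L^d children per block (blocks of
side L in d dimensions, (1.17)), the composition of the k one-step transformations with kernel constants a(L^jε)^{d−2},
j = 1, …, k, and block weight L^{−d} equals the k-th order transformation (2.10) with constant a_k(L^kε)^{d−2}, a_k of
(2.15), and block average Q_k(A) (`chainAvg`), on every integrable density of the ε-lattice fields; a, ε > 0, L > 1,
k ≥ 1. [cite: Balaban1982Higgs1, (2.16) p.609] -/
theorem display216 {a : ℝ} {L : ℕ} {ε : ℝ} (ha : 0 < a) (hL : 1 < L) (hε : 0 < ε) {d : ℕ}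
    (hB : Fintype.card B = L ^ d) {k : ℕ} (hk : 1 ≤ k) (Z : Type u) [Fintype Z]
    (u : (j : ℕ) → Sites B Z j × B → (V ≃ₗᵢ[ℝ] V)) (ρ : (Sites B Z k → V) → ℝ) (hρ : Integrable ρ) :
    rtChain (((L : ℝ) ^ d)⁻¹) k (precSeq a L ε d k) Z u ρ
      = rtOp (blockKernel (prec (B1.aSeq a L k) ((L : ℝ) ^ k * ε) d) (chainAvg (((L : ℝ) ^ d)⁻¹) k Z u)) ρ := by
  obtain ⟨n, rfl⟩ : ∃ n, k = n + 1 := ⟨k - 1, by omega⟩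
  have hL0 : 0 < L := lt_trans Nat.zero_lt_one hL
  rw [rtChain_succ_eq _ n _ (fun j => precSeq_pos ha hL0 hε d (n + 1) j) Z u ρ hρ, hB,
    chainPrec_printed ha hL hε d (n + 1) hk]

end Chain

end Literature.MathematicalPhysics.QuantumFieldTheory.Balaban1983to89.B1RTSemigroup
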